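import Mathlib.Analysis.Complex.RiemannMapping
import Mathlib.Analysis.Complex.Conformal
import Mathlib.Analysis.Complex.Convex
import Mathlib.Analysis.Complex.UpperHalfPlane.Topology
import Mathlib.Analysis.Convex.Contractible
import Mathlib.Logic.Equiv.PartialEquiv
import Mathlib.Topology.ExtendFrom
import Mathlib.AlgebraicTopology.FundamentalGroupoid.SimplyConnected
import Literature.Probability.RandomPlanarGeometry.PlanarDomains
import HarnessLib

-- provenance: harness21/H21/H21/Prelude/Stoch/ConformalMap.lean @ 42d0886 (interim HEAD d8f2665); M5 mechanical rewrite
/-!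
# Conformal equivalences, Riemann mapping and boundary behaviour (trunk `Stoch`)

This prelude file provides the complex-analytic uniformisation language used by the conformal
invariance statements of two-dimensional critical lattice models (Cardy–Smirnov, chordal SLE):

* `Literature.ConformalEquiv U V`: a *holomorphic* bijection `U → V` between subsets of `ℂ` with
  holomorphic inverse, bundled as a `PartialEquiv ℂ ℂ` with `source = U`, `target = V` and both
  directions `DifferentiableOn ℂ`; basic API (`symm`, `refl`, `trans`, `ext`, …) with real proofs, and
  the scaling maps `smulUpperHalfPlane c : ConformalEquiv ℍₒ ℍₒ` (`z ↦ c • z`, `0 < c`).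
* Boundary values by filters: `ConformalEquiv.HasBoundaryValue φ x p` (`φ → p` along `𝓝[U] x`),
  `ConformalEquiv.HasBoundaryValueAtInfty φ p` (`φ → p` along `cocompact ℂ ⊓ 𝓟 U`) and the extension
  `ConformalEquiv.boundaryExtension φ := extendFrom U φ`.
* The Riemann mapping theorem (`exists_conformalEquiv_ball`, `existsUnique_conformalEquiv_ball`,
  `exists_conformalEquiv_upperHalfPlaneSet`) and Carathéodory's theorem for Jordan domains
  (`JordanDomain.exists_continuousOn_extension` and its `ℍₒ`-side consequences), as sorried theorems
  with citations.

## Mathlib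

We USE `UpperHalfPlane.upperHalfPlaneSet = {z | 0 < z.im}` (notation `ℍₒ` in Mathlib, with
`UpperHalfPlane.isOpen_upperHalfPlaneSet`), `PartialEquiv`, `DifferentiableOn ℂ`, `deriv`,
`ConformalAt` / `DifferentiableAt.conformalAt`, `IsSimplyConnected` (+ `.nonempty`),
`Convex.contractibleSpace`, `convex_halfSpace_im_gt`, `extendFrom` / `extendFrom_eq`,
`Filter.cocompact`. Mathlib's `Analysis/Complex/RiemannMapping.lean` currently contains only partial
lemmas towards the Riemann mapping theorem (`exists_mapsTo_unitBall_injOn_deriv_ne_zero`), not the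
theorem itself; Mathlib has no bundled biholomorphism type. Only two facts about `ℍₒ` are added here:
`isSimplyConnected_upperHalfPlaneSet` and `upperHalfPlaneSet_ne_univ` (both proved).

## Design choices

* `ConformalEquiv` means holomorphic (orientation-preserving) conformal equivalence, as in complex
  analysis; Mathlib's `ConformalAt` also admits anti-holomorphic maps and is NOT what we bundle
  (it is a consequence: `ConformalEquiv.conformalAt`).
* One uniformising direction (outline D5): Riemann maps go `ℍₒ → U` (`ConformalEquiv ℍₒ U`); the disc
  versions `U → ball 0 1` are stated in the classical normalised form.
* Boundary behaviour is phrased with filters (`𝓝[U] x`, `cocompact ℂ ⊓ 𝓟 U`), avoiding the Riemann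
  sphere; the point at infinity of `∂ℍₒ` is handled by `HasBoundaryValueAtInfty`.

## References

* L. V. Ahlfors, *Complex Analysis*, 3rd ed. (1979), Ch. 6, §1.1, Thm 1 (Riemann mapping theorem).
* Ch. Pommerenke, *Boundary Behaviour of Conformal Maps* (1992), Thm 2.6 (Carathéodory).
* W. Werner, *Lectures on two-dimensional critical percolation*, IAS/Park City (2007), §2–3.
-/

open Set Filter Topology Complex
open UpperHalfPlane (upperHalfPlaneSet isOpen_upperHalfPlaneSet)

noncomputable section

namespace Literature.Probability.RandomPlanarGeometry

/-! ### The open upper half-plane `ℍₒ` -/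

/-- The open upper half-plane `ℍₒ = {z | 0 < im z}` is simply connected (it is convex, hence
contractible). Ahlfors, *Complex Analysis* (1979), Ch. 4 §4.2. [folklore] -/
theorem isSimplyConnected_upperHalfPlaneSet : IsSimplyConnected upperHalfPlaneSet := by
  have : ContractibleSpace upperHalfPlaneSet :=
    (convex_halfSpace_im_gt 0).contractibleSpace ⟨I, by simp⟩
  change SimplyConnectedSpace upperHalfPlaneSet
  infer_instance

/-- The open upper half-plane is a proper subset of `ℂ` (`-I ∉ ℍₒ`), as required by the Riemann
mapping theorem. Ahlfors, *Complex Analysis* (1979), Ch. 6 §1.1. [folklore] -/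
theorem upperHalfPlaneSet_ne_univ : upperHalfPlaneSet ≠ (univ : Set ℂ) := by
  intro h
  have hI : (-I : ℂ) ∈ upperHalfPlaneSet := by rw [h]; exact mem_univ _
  have hI' : (0 : ℝ) < (-I).im := hI
  norm_num at hI'

/-! ### Conformal equivalences -/

/-- A **conformal equivalence** (biholomorphism) between subsets `U V ⊆ ℂ`: a *holomorphic*
bijection `U → V` with *holomorphic* inverse, bundled as a `PartialEquiv ℂ ℂ` with `source = U`,
`target = V`, both directions being `DifferentiableOn ℂ`. This is the "conformal equivalence" of
complex analysis (orientation-preserving) — unlike Mathlib's `ConformalAt`, which also admits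
anti-holomorphic maps. Ahlfors, *Complex Analysis* (1979), Ch. 6 §1.1. [folklore] -/
structure ConformalEquiv (U V : Set ℂ) extends PartialEquiv ℂ ℂ where
  /-- The source of the underlying partial equivalence is `U`. -/
  source_eq : source = U
  /-- The target of the underlying partial equivalence is `V`. -/
  target_eq : target = V
  /-- The map is holomorphic on `U`. -/
  differentiableOn : DifferentiableOn ℂ toFun U
  /-- The inverse map is holomorphic on `V`. -/
  differentiableOn_symm : DifferentiableOn ℂ invFun V

namespace ConformalEquiv

variable {U V W : Set ℂ}

/-- A conformal equivalence coerces to the underlying function `ℂ → ℂ`. [folklore] -/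
instance instCoeFun : CoeFun (ConformalEquiv U V) fun _ ↦ ℂ → ℂ :=
  ⟨fun φ ↦ φ.toPartialEquiv⟩

/-- A conformal equivalence is holomorphic on its source (Ahlfors 1979, Ch. 6 §1.1). [cite: Ahlfors1979, Ch. 6 §1.1] -/
theorem differentiableOn_coe (φ : ConformalEquiv U V) : DifferentiableOn ℂ φ U :=
  φ.differentiableOn

/-- A conformal equivalence is continuous on its source (Ahlfors 1979, Ch. 6 §1.1). [cite: Ahlfors1979, Ch. 6 §1.1] -/
theorem continuousOn (φ : ConformalEquiv U V) : ContinuousOn φ U :=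
  φ.differentiableOn.continuousOn

/-- The inverse conformal equivalence `V → U` (Ahlfors 1979, Ch. 6 §1.1). [cite: Ahlfors1979, Ch. 6 §1.1] -/
@[symm]
def symm (φ : ConformalEquiv U V) : ConformalEquiv V U where
  toPartialEquiv := φ.toPartialEquiv.symm
  source_eq := φ.target_eq
  target_eq := φ.source_eq
  differentiableOn := φ.differentiableOn_symm
  differentiableOn_symm := φ.differentiableOn

/-- Unfolding the coercion of the inverse: `φ.symm z = φ.invFun z`. (The forward coercion goes
through `toPartialEquiv`, so `φ z` is *syntactically* `φ.toFun z` and needs no lemma.) [folklore] -/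
theorem symm_apply_eq (φ : ConformalEquiv U V) (z : ℂ) : φ.symm z = φ.invFun z := rfl

/-- The underlying partial equivalence of the inverse is the inverse partial equivalence. [folklore] -/
theorem symm_toPartialEquiv (φ : ConformalEquiv U V) :
    φ.symm.toPartialEquiv = φ.toPartialEquiv.symm := rfl

/-- `symm` is an involution. [folklore] -/
@[simp] theorem symm_symm (φ : ConformalEquiv U V) : φ.symm.symm = φ := rfl

/-- The identity conformal equivalence of a set `U ⊆ ℂ` (Ahlfors 1979, Ch. 6 §1.1). [cite: Ahlfors1979, Ch. 6 §1.1] -/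
@[refl]
def refl (U : Set ℂ) : ConformalEquiv U U where
  toPartialEquiv := PartialEquiv.ofSet U
  source_eq := rfl
  target_eq := rfl
  differentiableOn := differentiableOn_id
  differentiableOn_symm := differentiableOn_id

/-- The identity conformal equivalence is the identity map. [folklore] -/
@[simp] theorem refl_apply (U : Set ℂ) (z : ℂ) : refl U z = z := rfl

/-- A conformal equivalence maps `U` into `V`. [folklore] -/
theorem mapsTo (φ : ConformalEquiv U V) : MapsTo φ U V := by
  have h := φ.toPartialEquiv.mapsTo
  rwa [φ.source_eq, φ.target_eq] at h

/-- The inverse of a conformal equivalence maps `V` into `U`. [folklore] -/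
theorem symm_mapsTo (φ : ConformalEquiv U V) : MapsTo φ.symm V U :=
  φ.symm.mapsTo

/-- A conformal equivalence is a bijection `U → V`. [folklore] -/
theorem bijOn (φ : ConformalEquiv U V) : BijOn φ U V := by
  have h := φ.toPartialEquiv.bijOn
  rwa [φ.source_eq, φ.target_eq] at h

/-- A conformal equivalence is injective on `U`. [folklore] -/
theorem injOn (φ : ConformalEquiv U V) : InjOn φ U :=
  φ.bijOn.injOn

/-- `φ (φ.symm y) = y` for `y ∈ V`. [folklore] -/
@[simp] theorem apply_symm_apply (φ : ConformalEquiv U V) {y : ℂ} (hy : y ∈ V) :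
    φ (φ.symm y) = y :=
  φ.toPartialEquiv.right_inv (φ.target_eq.symm ▸ hy)

/-- `φ.symm (φ x) = x` for `x ∈ U`. [folklore] -/
@[simp] theorem symm_apply_apply (φ : ConformalEquiv U V) {x : ℂ} (hx : x ∈ U) :
    φ.symm (φ x) = x :=
  φ.toPartialEquiv.left_inv (φ.source_eq.symm ▸ hx)

/-- Composition of conformal equivalences `U → V → W` (Ahlfors 1979, Ch. 6 §1.1). [cite: Ahlfors1979, Ch. 6 §1.1] -/
@[trans]
def trans (φ : ConformalEquiv U V) (ψ : ConformalEquiv V W) : ConformalEquiv U W where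
  toPartialEquiv := φ.toPartialEquiv.trans' ψ.toPartialEquiv (φ.target_eq.trans ψ.source_eq.symm)
  source_eq := φ.source_eq
  target_eq := ψ.target_eq
  differentiableOn := ψ.differentiableOn.comp φ.differentiableOn φ.mapsTo
  differentiableOn_symm :=
    φ.symm.differentiableOn.comp ψ.symm.differentiableOn ψ.symm_mapsTo

/-- Composition of conformal equivalences is composition of functions. [folklore] -/
@[simp] theorem trans_apply (φ : ConformalEquiv U V) (ψ : ConformalEquiv V W) (z : ℂ) :
    φ.trans ψ z = ψ (φ z) := rfl

/-- Two conformal equivalences `U → V` with the same forward and inverse maps are equal (the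
sources and targets agree automatically). [folklore] -/
@[ext]
theorem ext {φ ψ : ConformalEquiv U V} (h : ∀ x, φ x = ψ x) (hsymm : ∀ y, φ.symm y = ψ.symm y) :
    φ = ψ := by
  obtain ⟨e, hs, ht, hd, hd'⟩ := φ
  obtain ⟨e', hs', ht', hd₁, hd₁'⟩ := ψ
  have : e = e' := PartialEquiv.ext h hsymm (hs.trans hs'.symm)
  subst this
  rfl

/-- The **scaling maps** of the upper half-plane: for a real `c > 0`, `z ↦ c • z` is a conformal
automorphism of `ℍₒ` with inverse `z ↦ c⁻¹ • z`. Needed for the scale invariance of chordal SLE.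
Ahlfors, *Complex Analysis* (1979), Ch. 3 §3.1 (linear transformations). [folklore] -/
def smulUpperHalfPlane (c : ℝ) (hc : 0 < c) : ConformalEquiv upperHalfPlaneSet upperHalfPlaneSet where
  toFun z := c • z
  invFun z := c⁻¹ • z
  source := upperHalfPlaneSet
  target := upperHalfPlaneSet
  map_source' z hz := by
    simp only [mem_setOf_eq, Complex.smul_im, smul_eq_mul] at hz ⊢
    exact mul_pos hc hz
  map_target' z hz := by
    simp only [mem_setOf_eq, Complex.smul_im, smul_eq_mul] at hz ⊢
    exact mul_pos (inv_pos.2 hc) hz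
  left_inv' z _ := by rw [smul_smul, inv_mul_cancel₀ hc.ne', one_smul]
  right_inv' z _ := by rw [smul_smul, mul_inv_cancel₀ hc.ne', one_smul]
  source_eq := rfl
  target_eq := rfl
  differentiableOn := differentiableOn_id.const_smul c
  differentiableOn_symm := differentiableOn_id.const_smul c⁻¹

/-- The scaling map acts as `z ↦ c • z`. [folklore] -/
@[simp] theorem smulUpperHalfPlane_apply (c : ℝ) (hc : 0 < c) (z : ℂ) :
    smulUpperHalfPlane c hc z = c • z := rfl

/-- The inverse of the scaling map acts as `z ↦ c⁻¹ • z`. [folklore] -/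
@[simp] theorem smulUpperHalfPlane_symm_apply (c : ℝ) (hc : 0 < c) (z : ℂ) :
    (smulUpperHalfPlane c hc).symm z = c⁻¹ • z := rfl

/-- The target of a conformal equivalence with open source is open (open mapping theorem applied
to the injective, hence nowhere locally constant, holomorphic map `φ` on `U`). Ahlfors, *Complex
Analysis* (1979), Ch. 4 §3.3, Cor. 1; cf. Mathlib's `AnalyticOnNhd.is_constant_or_isOpen`. [cite: AhlforsCA1979, Ch. 4 §3.3 Cor. 1] -/
def isOpen_target : Prop :=
  ∀ (φ : ConformalEquiv U V) (hU : IsOpen U),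
    IsOpen V

/-- The derivative of a conformal equivalence does not vanish on its (open) source: by the chain
rule `deriv φ.symm (φ z) * deriv φ z = 1`. Ahlfors, *Complex Analysis* (1979), Ch. 4 §3.3,
Cor. 2 and Ch. 6 §1.1. [cite: AhlforsCA1979, Ch. 4 §3.3 Cor. 2 and Ch. 6 §1.1] -/
def deriv_ne_zero : Prop :=
  ∀ (φ : ConformalEquiv U V) (hU : IsOpen U) {z : ℂ} (hz : z ∈ U),
    deriv φ z ≠ 0

/-- A conformal equivalence is conformal (angle-preserving) at every point of its open source, in
Mathlib's sense `ConformalAt`. Ahlfors, *Complex Analysis* (1979), Ch. 3 §2.3. [folklore] -/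
def conformalAt : Prop :=
  ∀ (φ : ConformalEquiv U V) (hU : IsOpen U) {z : ℂ} (hz : z ∈ U),
    ConformalAt φ z

/- interim proof relied on results that are now named facts (D-0014); demoted to a fact by the M5 import, proof preserved:
:=
  ((φ.differentiableOn z hz).differentiableAt (hU.mem_nhds hz)).conformalAt (φ.deriv_ne_zero hU hz)
-/

/-! ### Boundary values -/

/-- The conformal equivalence `φ : U → V` has **boundary value** `p` at the point `x` (typically
`x ∈ frontier U`): `φ z → p` as `z → x` within `U`. Pommerenke, *Boundary Behaviour of Conformal
Maps* (1992), §2.1. [folklore] -/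
def HasBoundaryValue (φ : ConformalEquiv U V) (x p : ℂ) : Prop :=
  Tendsto φ (𝓝[U] x) (𝓝 p)

/-- The conformal equivalence `φ : U → V` has **boundary value** `p` **at infinity**: `φ z → p` as
`z → ∞` within `U` (filter `cocompact ℂ ⊓ 𝓟 U`). For `U = ℍₒ` this is the boundary value at the
boundary point `∞ ∈ ∂ℍₒ ⊆ ℂ ∪ {∞}`. Pommerenke (1992), §2.1. [cite: Pommerenke1992] -/
def HasBoundaryValueAtInfty (φ : ConformalEquiv U V) (p : ℂ) : Prop :=
  Tendsto φ (cocompact ℂ ⊓ 𝓟 U) (𝓝 p)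

/-- The **boundary extension** of a conformal equivalence `φ : U → V`: the extension of `φ|U` to
`closure U` by limits within `U` (`extendFrom U φ`); it agrees with `φ` on `U` and takes the boundary
value at every boundary point where one exists (junk elsewhere). Pommerenke (1992), §2.1. [cite: Pommerenke1992] -/
def boundaryExtension (φ : ConformalEquiv U V) : ℂ → ℂ :=
  extendFrom U φ

/-- The boundary extension agrees with `φ` on `U`. [folklore] -/
theorem boundaryExtension_eq (φ : ConformalEquiv U V) {z : ℂ} (hz : z ∈ U) :
    φ.boundaryExtension z = φ z :=
  extendFrom_extends φ.continuousOn z hz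

/-- At a point of `closure U` where `φ` has boundary value `p`, the boundary extension equals `p`. [folklore] -/
theorem boundaryExtension_eq_of_hasBoundaryValue (φ : ConformalEquiv U V) {x p : ℂ}
    (hx : x ∈ closure U) (h : φ.HasBoundaryValue x p) : φ.boundaryExtension x = p :=
  extendFrom_eq hx h

/-- `HasBoundaryValue` at an interior point `z ∈ U` just means the value is `φ z`. [folklore] -/
theorem hasBoundaryValue_apply (φ : ConformalEquiv U V) {z : ℂ} (hz : z ∈ U) :
    φ.HasBoundaryValue z (φ z) :=
  φ.continuousOn z hz

end ConformalEquiv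

/-! ### The Riemann mapping theorem -/

section RiemannMapping

variable {U : Set ℂ}

/-- **Riemann mapping theorem** (existence, disc form): every simply connected open proper subset
`U ⊊ ℂ` is conformally equivalent to the open unit disc. (`U` is nonempty by
`IsSimplyConnected.nonempty`.) Ahlfors, *Complex Analysis* (1979), Ch. 6 §1.1, Thm 1. Mathlib has
only partial lemmas (`Analysis/Complex/RiemannMapping.lean`). [cite: AhlforsCA1979, Ch. 6 §1.1 Thm. 1] -/
def exists_conformalEquiv_ball : Prop :=
  ∀ (hU : IsOpen U) (hsc : IsSimplyConnected U) (hU' : U ≠ univ),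
    Nonempty (ConformalEquiv U (Metric.ball 0 1))

/-- **Riemann mapping theorem** (normalised form): for `z₀ ∈ U`, `U ⊊ ℂ` open and simply connected,
there is a unique conformal equivalence `φ : U → 𝔻` with `φ z₀ = 0` and `φ' z₀ > 0` (real and
positive). Ahlfors, *Complex Analysis* (1979), Ch. 6 §1.1, Thm 1. Uniqueness is stated as
`EqOn ψ φ U` rather than `∃! φ`, because a `ConformalEquiv` carries (junk) values of the forward
and inverse maps outside `U` and `𝔻`, so equality of structures would be false. [cite: AhlforsCA1979, Ch. 6 §1.1 Thm. 1] -/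
def existsUnique_conformalEquiv_ball : Prop :=
  ∀ (hU : IsOpen U) (hsc : IsSimplyConnected U) (hU' : U ≠ univ) {z₀ : ℂ} (hz₀ : z₀ ∈ U),
    ∃ φ : ConformalEquiv U (Metric.ball 0 1), (φ z₀ = 0 ∧ 0 < (deriv φ z₀).re ∧
      (deriv φ z₀).im = 0) ∧ ∀ ψ : ConformalEquiv U (Metric.ball 0 1),
      ψ z₀ = 0 → 0 < (deriv ψ z₀).re → (deriv ψ z₀).im = 0 → EqOn ψ φ U

/-- **Riemann mapping theorem** (half-plane form, the uniformising direction used throughout the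
`Stoch` trunk): every simply connected open proper subset `U ⊊ ℂ` is the image of the upper
half-plane `ℍₒ` under a conformal equivalence `ℍₒ → U`. Ahlfors, *Complex Analysis* (1979),
Ch. 6 §1.1, Thm 1 (composed with the Cayley transform `𝔻 ≃ ℍₒ`). [cite: AhlforsCA1979, Ch. 6 §1.1 Thm. 1 (with the Cayley transform)] -/
def exists_conformalEquiv_upperHalfPlaneSet : Prop :=
  ∀ (hU : IsOpen U) (hsc : IsSimplyConnected U) (hU' : U ≠ univ),
    Nonempty (ConformalEquiv upperHalfPlaneSet U)

end RiemannMapping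

/-! ### Carathéodory's theorem for Jordan domains -/

namespace JordanDomain

/-- **Carathéodory's theorem** (disc form): a conformal equivalence of the unit disc onto a Jordan
domain `D` extends continuously to the closed disc, the extension being a bijection (indeed a
homeomorphism) `closedBall 0 1 → closure D` mapping the unit circle bijectively onto `∂D`.
Pommerenke, *Boundary Behaviour of Conformal Maps* (1992), Thm 2.6. [cite: PommerenkeBBCM1992, Thm. 2.6] -/
def exists_continuousOn_extension : Prop :=
  ∀ (D : JordanDomain) (φ : ConformalEquiv (Metric.ball 0 1) D.carrier),
    ∃ Φ : ℂ → ℂ, ContinuousOn Φ (Metric.closedBall 0 1) ∧ EqOn Φ φ (Metric.ball 0 1) ∧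
      BijOn Φ (Metric.closedBall 0 1) (closure D.carrier) ∧
      BijOn Φ (Metric.sphere 0 1) (frontier D.carrier)

/-- Carathéodory, half-plane form: a conformal equivalence `φ : ℍₒ → D` onto a Jordan domain has a
boundary value on `∂D` at every real point `x`. Pommerenke (1992), Thm 2.6 (via the Cayley
transform). [cite: Pommerenke1992] -/
def exists_hasBoundaryValue : Prop :=
  ∀ (D : JordanDomain) (φ : ConformalEquiv upperHalfPlaneSet D.carrier) (x : ℝ),
    ∃ p ∈ frontier D.carrier, φ.HasBoundaryValue x p

/-- Carathéodory, half-plane form: a conformal equivalence `φ : ℍₒ → D` onto a Jordan domain has a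
boundary value on `∂D` at infinity. Pommerenke (1992), Thm 2.6 (via the Cayley transform). [cite: Pommerenke1992] -/
def exists_hasBoundaryValueAtInfty : Prop :=
  ∀ (D : JordanDomain) (φ : ConformalEquiv upperHalfPlaneSet D.carrier),
    ∃ p ∈ frontier D.carrier, φ.HasBoundaryValueAtInfty p

/-- Carathéodory, half-plane form: every boundary point `p ∈ ∂D` of a Jordan domain is the boundary
value of `φ : ℍₒ → D` either at exactly one real point, or at infinity (the boundary
correspondence `ℝ ∪ {∞} → ∂D` is a bijection). Pommerenke (1992), Thm 2.6. [cite: Pommerenke1992] -/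
def existsUnique_real_or_infty : Prop :=
  ∀ (D : JordanDomain) (φ : ConformalEquiv upperHalfPlaneSet D.carrier) {p : ℂ} (hp : p ∈ frontier D.carrier),
    (∃! x : ℝ, φ.HasBoundaryValue x p) ∨ φ.HasBoundaryValueAtInfty p

/-- Carathéodory, half-plane form: the boundary extension of `φ : ℍₒ → D` is continuous on the
closed upper half-plane. Pommerenke (1992), Thm 2.6. [cite: Pommerenke1992] -/
def continuousOn_boundaryExtension : Prop :=
  ∀ (D : JordanDomain) (φ : ConformalEquiv upperHalfPlaneSet D.carrier),
    ContinuousOn φ.boundaryExtension (closure upperHalfPlaneSet)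

/-- Carathéodory, half-plane form: the boundary extension of `φ : ℍₒ → D` maps the closed upper
half-plane into `closure D` (onto `closure D` minus the boundary value at infinity).
Pommerenke (1992), Thm 2.6. [cite: Pommerenke1992] -/
def mapsTo_boundaryExtension : Prop :=
  ∀ (D : JordanDomain) (φ : ConformalEquiv upperHalfPlaneSet D.carrier),
    MapsTo φ.boundaryExtension (closure upperHalfPlaneSet) (closure D.carrier)

end JordanDomain

end Literature.Probability.RandomPlanarGeometry
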